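import Literature.Probability.MarkovChains.TreeEffectiveResistance
import Literature.Combinatorics.SimpleGraph.TreeDecomposition
import HarnessLib

/-!
# The path graph `P_n`: `d(i,j) = |i − j|`, `r_{P_n}(i,j) = d(i,j)` (Faught–Kempton–Knudson Prop. 3.1), and
# `Kf(P_n) = 𝒲(P_n) = Σ_{k=1}^{n−1} k(n−k) = n(n²−1)/6`

Sources (read at the page; VERBATIM). N. Faught, M. Kempton, A. Knudson, *A 1-separation formula for the graph Kemeny
constant and Braess edges*, J. Math. Chem. 60 (2022) 49–69, arXiv:2108.01061 [FaughtKemptonKnudson2021] (held text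
`paper:arxiv-2108.01061`, p0009): **Proposition 3.1** «Let `K_n` and `P_n` be, respectively, the complete graph and path
graph on `n` vertices `{1, 2, …, n}`. Then `r_{K_n}(i,j) = 2/n`, `r_{P_n}(i,j) = d(i,j)` where `d(i,j)` is the distance
from `i` to `j`.» S. J. Kirkland, M. Neumann, *Group Inverses of M-Matrices and Their Applications* (CRC 2012)
[KirklandNeumann2012] (held text, p0176, p0188): **Example 7.3.3** («the unweighted path on `n` vertices, `P_n` […]
`Σ_{k=1}^{n−1} k(n−k) = n(n²−1)/6`») and **Corollary 7.4.10** («`Kf(𝒢) ≤ 𝒲(𝒢)`, with equality holding if and only if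
`𝒢` is a tree»; `𝒲` the Wiener index `Σ_{i<j} d(i,j)`). D. A. Levin, Y. Peres, *Markov Chains and Mixing Times*
[LevinPeres2017], §9.4 **Example 9.7** (on a tree `R(a ↔ z)` is the length of the path), the tree's
`LevinPeres2017_example_9_7`.

## Tree vocabulary

Mathlib's `SimpleGraph.pathGraph n` on `Fin n` (`i ∼ j ↔ i + 1 = j ∨ j + 1 = i`, vertices `0, …, n−1`), its graph
distance `SimpleGraph.dist`, the tree's `Literature.Combinatorics.SimpleGraph.isTree_pathGraph`; unit conductances
`(pathGraph n).adjMatrix ℝ` (any `DecidableRel` instance for the adjacency), `r(i,j) = effectiveResistance (·) i j`,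
`Kf = ½ Σ_i Σ_j r(i,j)`, `𝒲 = ½ Σ_i Σ_j d(i,j)`.

* `pathGraph_dist_of_le`, `pathGraph_dist_cast` — **`d(i,j) = |i − j|`** on `P_n` (the metric of a path, as used in
  [FaughtKemptonKnudson2021, Prop. 3.1–3.2]);
* `FaughtKemptonKnudson2021_prop_3_1_path` — **`r_{P_n}(i,j) = d(i,j) = |i − j|`** [cite: FaughtKemptonKnudson2021,
  Prop. 3.1] (proof: Example 9.7 with a geodesic, which is a path);
* `sum_sum_abs_sub_fin` — `Σ_{i,j<n} |i − j| = n(n²−1)/3` (twice `Σ_{k=1}^{n−1} k(n−k) = n(n²−1)/6`,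
  [cite: KirklandNeumann2012, Example 7.3.3]);
* `wienerIndex_pathGraph` — `𝒲(P_n) = n(n²−1)/6`; `kirchhoffIndex_pathGraph` — **`Kf(P_n) = n(n²−1)/6`** (`= 𝒲(P_n)`,
  Cor. 7.4.10's equality for the tree `P_n`) [cite: KirklandNeumann2012, §7.4 Cor. 7.4.10 with Example 7.3.3].

THEOREMS ONLY (no definition, no named fact, net debt 0); `n = k + 2 ≥ 2` throughout the resistance statements.
-/

noncomputable section

open Finset Matrix SimpleGraph
open Literature.Combinatorics.SimpleGraph

namespace Literature.Probability.MarkovChains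

/-! ## §1 The metric of the path graph: `d(i,j) = |i − j|` -/

/-- A walk `i — i+1 — ⋯ — j` of length `j − i` in `P_n` (`i ≤ j`). [folklore] -/
private theorem pathGraph_exists_walk_of_le {k : ℕ} (i j : Fin (k + 1)) (h : i ≤ j) :
    ∃ p : (pathGraph (k + 1)).Walk i j, p.length = (j : ℕ) - i := by
  obtain ⟨d, hd⟩ : ∃ d : ℕ, (j : ℕ) = i + d := ⟨j - i, by rw [Fin.le_def] at h; omega⟩
  induction d generalizing j with
  | zero =>
    have hij : j = i := Fin.ext (by omega)
    subst hij
    exact ⟨Walk.nil, by simp⟩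
  | succ d ih =>
    have hj' : (i : ℕ) + d < k + 1 := by have := j.isLt; omega
    obtain ⟨p, hp⟩ := ih ⟨(i : ℕ) + d, hj'⟩ (by rw [Fin.le_def]; simp) rfl
    have hadj : (pathGraph (k + 1)).Adj ⟨(i : ℕ) + d, hj'⟩ j := by
      rw [pathGraph_adj]
      left
      simp only
      omega
    refine ⟨p.append (Walk.cons hadj Walk.nil), ?_⟩
    rw [Walk.length_append, Walk.length_cons, Walk.length_nil, hp]
    simp only
    omega

/-- Along any walk of `P_n` the label changes by at most the length. [folklore] -/
private theorem pathGraph_walk_length_ge {k : ℕ} {i j : Fin (k + 1)} (p : (pathGraph (k + 1)).Walk i j) :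
    (j : ℕ) ≤ i + p.length ∧ (i : ℕ) ≤ j + p.length := by
  induction p with
  | nil => simp
  | @cons u v w huv p ih =>
    rw [pathGraph_adj] at huv
    rw [Walk.length_cons]
    omega

/-- **`d(i,j) = j − i` on the path graph for `i ≤ j`** («`d(i,j)` is the distance from `i` to `j`» on `P_n` with
vertices labelled consecutively). [cite: FaughtKemptonKnudson2021, §3 Prop. 3.1 (the distance `d(i,j)` on `P_n`)] -/
theorem pathGraph_dist_of_le {k : ℕ} {i j : Fin (k + 1)} (h : i ≤ j) :
    (pathGraph (k + 1)).dist i j = (j : ℕ) - i := by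
  obtain ⟨p, hp⟩ := pathGraph_exists_walk_of_le i j h
  refine le_antisymm (hp ▸ dist_le p) ?_
  obtain ⟨q, hq⟩ := (pathGraph_connected k).exists_walk_length_eq_dist i j
  have h1 := (pathGraph_walk_length_ge q).1
  omega

/-- **`d(i,j) = |i − j|` on the path graph** (as a real number). [cite: FaughtKemptonKnudson2021, §3 Prop. 3.1 (the
distance `d(i,j)` on `P_n`; Prop. 3.2 uses it as `|i − j|` in `μ(P_n, j) = (n−j)² + (j−1)²`)] -/
theorem pathGraph_dist_cast {k : ℕ} (i j : Fin (k + 1)) :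
    (((pathGraph (k + 1)).dist i j : ℕ) : ℝ) = |((i : ℕ) : ℝ) - ((j : ℕ) : ℝ)| := by
  rcases le_total i j with h | h
  · have h' : (i : ℕ) ≤ j := Fin.le_def.1 h
    rw [pathGraph_dist_of_le h, Nat.cast_sub h', abs_sub_comm,
      abs_of_nonneg (sub_nonneg.2 (Nat.cast_le.2 h'))]
  · have h' : (j : ℕ) ≤ i := Fin.le_def.1 h
    rw [dist_comm, pathGraph_dist_of_le h, Nat.cast_sub h', abs_of_nonneg (sub_nonneg.2 (Nat.cast_le.2 h'))]

/-! ## §2 Proposition 3.1: `r_{P_n}(i,j) = d(i,j)` -/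

/-- **PROPOSITION 3.1 (path part): «`r_{P_n}(i,j) = d(i,j)` where `d(i,j)` is the distance from `i` to `j`»**, i.e.
`= |i − j|`, for unit resistances on `P_n` (`n ≥ 2`). Proof: `P_n` is a tree and a geodesic is a path (Example 9.7).
[cite: FaughtKemptonKnudson2021, §3 Prop. 3.1] [cite: LevinPeres2017, §9.4 Example 9.7] -/
theorem FaughtKemptonKnudson2021_prop_3_1_path {k : ℕ} [DecidableRel (pathGraph (k + 2)).Adj] (i j : Fin (k + 2)) :
    effectiveResistance ((pathGraph (k + 2)).adjMatrix ℝ) i j = |((i : ℕ) : ℝ) - ((j : ℕ) : ℝ)| := by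
  obtain ⟨p, hp⟩ := (pathGraph_connected (k + 1)).exists_walk_length_eq_dist i j
  rw [LevinPeres2017_example_9_7 (isTree_pathGraph (k + 1)) p (p.isPath_of_length_eq_dist hp), hp,
    pathGraph_dist_cast]

/-- `r_{P_n}(i,j) = d(i,j)` with Mathlib's `dist`. [cite: FaughtKemptonKnudson2021, §3 Prop. 3.1] -/
theorem FaughtKemptonKnudson2021_prop_3_1_path_dist {k : ℕ} [DecidableRel (pathGraph (k + 2)).Adj]
    (i j : Fin (k + 2)) :
    effectiveResistance ((pathGraph (k + 2)).adjMatrix ℝ) i j = (pathGraph (k + 2)).dist i j := by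
  rw [FaughtKemptonKnudson2021_prop_3_1_path, pathGraph_dist_cast]

/-! ## §3 `Σ_{k=1}^{n−1} k(n−k) = n(n²−1)/6` and `Kf(P_n) = 𝒲(P_n) = n(n²−1)/6` -/

/-- `Σ_{i<n} i = n(n−1)/2`. [folklore] -/
private theorem sum_range_cast_eq_half_mul (n : ℕ) : ∑ i ∈ range n, (i : ℝ) = (n : ℝ) * ((n : ℝ) - 1) / 2 := by
  induction n with
  | zero => simp
  | succ n ih =>
    rw [sum_range_succ, ih]
    push_cast
    ring

/-- **`Σ_{i<n} Σ_{j<n} |i − j| = n(n²−1)/3`** — twice «`Σ_{k=1}^{n−1} k(n−k) = n(n²−1)/6`» (grouping the ordered pairs by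
`k = |i − j|`). [cite: KirklandNeumann2012, §7.3 Example 7.3.3] -/
theorem sum_sum_range_abs_sub (n : ℕ) :
    ∑ i ∈ range n, ∑ j ∈ range n, |(i : ℝ) - (j : ℝ)| = (n : ℝ) * ((n : ℝ) ^ 2 - 1) / 3 := by
  induction n with
  | zero => simp
  | succ n ih =>
    have hA : ∑ i ∈ range n, |(i : ℝ) - (n : ℝ)| = (n : ℝ) * ((n : ℝ) + 1) / 2 := by
      rw [show ∑ i ∈ range n, |(i : ℝ) - (n : ℝ)| = ∑ i ∈ range n, ((n : ℝ) - i) from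
        sum_congr rfl fun i hi => by
          rw [abs_sub_comm, abs_of_nonneg]
          exact sub_nonneg.2 (Nat.cast_le.2 (mem_range.1 hi).le)]
      rw [sum_sub_distrib, sum_const, card_range, nsmul_eq_mul, sum_range_cast_eq_half_mul]
      ring
    have hA' : ∑ j ∈ range n, |(n : ℝ) - (j : ℝ)| = (n : ℝ) * ((n : ℝ) + 1) / 2 := by
      rw [← hA]
      exact sum_congr rfl fun j _ => abs_sub_comm _ _
    rw [sum_range_succ]
    simp_rw [sum_range_succ]
    rw [sum_add_distrib, ih, hA, hA', sub_self, abs_zero, add_zero]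
    push_cast
    ring

/-- The same over `Fin n`: `Σ_i Σ_j |i − j| = n(n²−1)/3`. [cite: KirklandNeumann2012, §7.3 Example 7.3.3] -/
theorem sum_sum_abs_sub_fin (n : ℕ) :
    ∑ i : Fin n, ∑ j : Fin n, |((i : ℕ) : ℝ) - ((j : ℕ) : ℝ)| = (n : ℝ) * ((n : ℝ) ^ 2 - 1) / 3 := by
  have h1 : ∀ i : Fin n, ∑ j : Fin n, |((i : ℕ) : ℝ) - ((j : ℕ) : ℝ)| = ∑ j ∈ range n, |((i : ℕ) : ℝ) - (j : ℝ)| :=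
    fun i => Fin.sum_univ_eq_sum_range (fun j => |((i : ℕ) : ℝ) - (j : ℝ)|) n
  simp_rw [h1]
  rw [Fin.sum_univ_eq_sum_range (fun i => ∑ j ∈ range n, |(i : ℝ) - (j : ℝ)|) n, sum_sum_range_abs_sub]

/-- **The Wiener index of the path: `𝒲(P_n) = ½ Σ_i Σ_j d(i,j) = n(n²−1)/6`** (`n = k + 1 ≥ 1`).
[cite: KirklandNeumann2012, §7.3 Example 7.3.3 (`Σ_{k=1}^{n−1} k(n−k) = n(n²−1)/6`) with §7.4 Cor. 7.4.10 (`𝒲`)] -/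
theorem wienerIndex_pathGraph (k : ℕ) :
    (1 / 2 : ℝ) * ∑ i : Fin (k + 1), ∑ j : Fin (k + 1), (((pathGraph (k + 1)).dist i j : ℕ) : ℝ) =
      ((k : ℝ) + 1) * (((k : ℝ) + 1) ^ 2 - 1) / 6 := by
  simp_rw [pathGraph_dist_cast]
  rw [sum_sum_abs_sub_fin]
  push_cast
  ring

/-- **The Kirchhoff index of the path: `Kf(P_n) = ½ Σ_i Σ_j r(i,j) = n(n²−1)/6 = 𝒲(P_n)`** (`n = k + 2 ≥ 2`) — the
equality case of Corollary 7.4.10 for the tree `P_n`, in closed form. [cite: KirklandNeumann2012, §7.4 Cor. 7.4.10 with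
§7.3 Example 7.3.3] [cite: FaughtKemptonKnudson2021, §3 Prop. 3.1] -/
theorem kirchhoffIndex_pathGraph (k : ℕ) [DecidableRel (pathGraph (k + 2)).Adj] :
    (1 / 2 : ℝ) * ∑ i : Fin (k + 2), ∑ j : Fin (k + 2), effectiveResistance ((pathGraph (k + 2)).adjMatrix ℝ) i j =
      ((k : ℝ) + 2) * (((k : ℝ) + 2) ^ 2 - 1) / 6 := by
  simp_rw [FaughtKemptonKnudson2021_prop_3_1_path]
  rw [sum_sum_abs_sub_fin]
  push_cast
  ring

/-- `Kf(P_n) = 𝒲(P_n)`. [cite: KirklandNeumann2012, §7.4 Cor. 7.4.10 (equality for trees)] -/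
theorem kirchhoffIndex_pathGraph_eq_wienerIndex (k : ℕ) [DecidableRel (pathGraph (k + 2)).Adj] :
    (1 / 2 : ℝ) * ∑ i : Fin (k + 2), ∑ j : Fin (k + 2), effectiveResistance ((pathGraph (k + 2)).adjMatrix ℝ) i j =
      (1 / 2 : ℝ) * ∑ i : Fin (k + 2), ∑ j : Fin (k + 2), (((pathGraph (k + 2)).dist i j : ℕ) : ℝ) := by
  rw [kirchhoffIndex_pathGraph, wienerIndex_pathGraph (k + 1)]
  push_cast
  ring

end Literature.Probability.MarkovChains
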